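import Summits.QuantumFields.YangMills.Theorems.BalabanUVNodesK0VariationalThm1ScaledCorner

/-!
# K0‴ ∕ RECORD13 gate ROW P11 — THE CORNER PLAQUETTE, SHARP FLOORS (part 2): `VariationalThm1ScaledSep → 2L² ≤ B₃`, `VariationalThm1Class → L² ≤ B₃`

Cell `pub-ymgap`, seat `pub-ymgap-dag-n21-c` (g5), `--supports stmt-QuantumFields-19909 --as helper` (K0‴ ROW P11).  COUNT-NEUTRAL.  Referee-H g5's note on
part 1 (pub-ymgap INBOX l.16520): in a ONE-BOND configuration every plaquette containing the bond has holonomy `g`, `g⁻¹` or `1` — so its `dist1` is AT MOST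
`dist1 g` (not `4·dist1 g`, part 2 of the ₁₂ certificate's crude bound), and the corner datum may be taken anywhere in `[0, δ₀)`.  With this the corner plaquette
of part 1 gives the floors the numerics desks must respect: `2·L² ≤ B₃` under the faithful `VariationalThm1ScaledSep` (comparability `δ₀ ≤ 2δ₁` at equality) and
`L² ≤ B₃` under the printed uniform `VariationalThm1Class` (`δ₀ = δ₁ = ε₁`).

WHAT IS PROVED ([folklore] bookkeeping; nothing of Bałaban asserted or refuted — floors on a constant of TREE-TYPED named facts).
§1 `exists_oneBond_cfg_sharp` (value `g` on the first bond of `p`, `1` elsewhere: `U(∂p) = g` and EVERY `dist1 (U(∂q)) ≤ dist1 g`).  §2 ★ `corner_forces_sharp`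
(part 1's `corner_forces` with the data room `t < δ₀`).  §3 ★★ `two_sq_L_le_of_variationalThm1ScaledSep` (`…Sep F N B₃ a₀ a₁ → 2·(F.L)² ≤ B₃`, `N ≥ 2`, `a₀, a₁ > 0`),
`not_variationalThm1ScaledSep_of_lt_two_sq`; ★ `sq_L_le_of_variationalThm1Class` (`…Class F N B₃ a₀ a₁ → (F.L)² ≤ B₃`), `not_variationalThm1Class_of_lt_sq`.
CONSEQUENCE (node00-def-K0a ∕ def-T numerals): a pin `B₃ < 2L²` (`< 338` at `L = 13`) makes `…ScaledSep` FALSE at that numeral and any chain keyed on it vacuous;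
print's «B₃ depends on d and L only» ([15] Thm 1) is consistent with `B₃ ≥ 2L²` (the corner plaquette is print's own).  HONEST FRAMING: K0′∕K0‴ neither discharged
nor refuted; counts unmoved (typed 28∕28 · discharged 5∕27); one finite `𝕋⁴` torus family; not continuum ∕ OS ∕ mass gap ∕ Clay.  No `sorry`∕`def`∕`instance`∕`notation`.
DEPENDENCES (by name): part 1 (`exists_seq_singleCube`, `exists_corner_plaq`, `lt_sitesPerDir_zero`, `plaqHol_eq_of_agreeOn`, `eta_one_sq(_le_one)`), ₁₂ part 2
`shift_ne_self ∕ one_lt_sitesPerDir_zero`, ₁₂ part 4 `exists_su_conj_norm_sub_one_ge`; node00-def-P11 `VariationalThm1ScaledSep ∕ VariationalThm1Class`.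
-/

noncomputable section

open scoped Matrix.Norms.L2Operator

namespace Summit.QuantumFields.YangMills.Theorems.K0VariationalThm1ScaledCorner

open Literature.MathematicalPhysics.QuantumFieldTheory.Balaban1983to89
open Literature.MathematicalPhysics.QuantumFieldTheory.Balaban1983to89.Node00
open Literature.MathematicalPhysics.QuantumFieldTheory.Balaban1983to89.T4Continuum
open B15DeterminingSets
open Summit.QuantumFields.YangMills.Theorems.K0BgProvisoOverRange (shift_ne_self one_lt_sitesPerDir_zero exists_su_conj_norm_sub_one_ge)

/-! ## §1  The one-bond configuration, sharp: every plaquette variable is `g`, `g⁻¹` or `1` -/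
section OneBond

variable {P : Params} {G : Type*} [GaugeGroup G]

/-- **The one-bond configuration, sharp**: value `g` on the first bond `⟨p.src, p.μ⟩` of `p`, `1` elsewhere; `U(∂p) = g`, and since a plaquette's four bonds are
pairwise distinct, every plaquette variable is `g`, `g⁻¹` or `1`, hence within `dist1 g` of `1` (`dist1_inv`). [cite: Balaban1985Averaging, (3) p.18 (bookkeeping)] -/
theorem exists_oneBond_cfg_sharp (hper : 1 < P.sitesPerDir 0) (g : G) (p : Plaq P 0) :
    ∃ U : GaugeField P 0 G, GaugeField.plaqHol U p = g ∧ ∀ q, dist1 (GaugeField.plaqHol U q) ≤ dist1 g := by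
  classical
  set b₀ : PBond P 0 := ⟨p.src, p.μ⟩ with hb₀
  set U : GaugeField P 0 G := fun b => if b = b₀ then g else 1 with hU
  have hUb : ∀ b : PBond P 0, U b = if b = b₀ then g else 1 := fun b => rfl
  refine ⟨U, ?_, fun q => ?_⟩
  · have hne : p.μ ≠ p.ν := fun h => absurd p.hμν (by rw [h]; exact lt_irrefl _)
    have h2 : (⟨p.src.shift p.μ, p.ν⟩ : PBond P 0) ≠ b₀ := fun h => hne.symm (congrArg PBond.dir h)
    have h3 : (⟨p.src.shift p.ν, p.μ⟩ : PBond P 0) ≠ b₀ := fun h => shift_ne_self hper p.src p.ν (congrArg PBond.src h)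
    have h4 : (⟨p.src, p.ν⟩ : PBond P 0) ≠ b₀ := fun h => hne.symm (congrArg PBond.dir h)
    rw [GaugeField.plaqHol, hUb, hUb, hUb, hUb, if_pos rfl, if_neg h2, if_neg h3, if_neg h4]
    simp only [mul_one, inv_one]
  · -- the four bonds of `q` are pairwise distinct
    have hne : q.μ ≠ q.ν := fun h => absurd q.hμν (by rw [h]; exact lt_irrefl _)
    have d12 : (⟨q.src, q.μ⟩ : PBond P 0) ≠ ⟨q.src.shift q.μ, q.ν⟩ := fun h => hne (congrArg PBond.dir h)
    have d13 : (⟨q.src, q.μ⟩ : PBond P 0) ≠ ⟨q.src.shift q.ν, q.μ⟩ := fun h => (shift_ne_self hper q.src q.ν) (congrArg PBond.src h).symm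
    have d14 : (⟨q.src, q.μ⟩ : PBond P 0) ≠ ⟨q.src, q.ν⟩ := fun h => hne (congrArg PBond.dir h)
    have d23 : (⟨q.src.shift q.μ, q.ν⟩ : PBond P 0) ≠ ⟨q.src.shift q.ν, q.μ⟩ := fun h => hne.symm (congrArg PBond.dir h)
    have d24 : (⟨q.src.shift q.μ, q.ν⟩ : PBond P 0) ≠ ⟨q.src, q.ν⟩ := fun h => (shift_ne_self hper q.src q.μ) (congrArg PBond.src h)
    have d34 : (⟨q.src.shift q.ν, q.μ⟩ : PBond P 0) ≠ ⟨q.src, q.ν⟩ := fun h => hne (congrArg PBond.dir h)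
    have h0 : (0 : ℝ) ≤ dist1 g := GaugeGroup.dist1_nonneg g
    rw [GaugeField.plaqHol, hUb, hUb, hUb, hUb]
    by_cases e1 : (⟨q.src, q.μ⟩ : PBond P 0) = b₀
    · have e2 : (⟨q.src.shift q.μ, q.ν⟩ : PBond P 0) ≠ b₀ := fun h => d12 (e1.trans h.symm)
      have e3 : (⟨q.src.shift q.ν, q.μ⟩ : PBond P 0) ≠ b₀ := fun h => d13 (e1.trans h.symm)
      have e4 : (⟨q.src, q.ν⟩ : PBond P 0) ≠ b₀ := fun h => d14 (e1.trans h.symm)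
      rw [if_pos e1, if_neg e2, if_neg e3, if_neg e4]; simp
    by_cases e2 : (⟨q.src.shift q.μ, q.ν⟩ : PBond P 0) = b₀
    · have e3 : (⟨q.src.shift q.ν, q.μ⟩ : PBond P 0) ≠ b₀ := fun h => d23 (e2.trans h.symm)
      have e4 : (⟨q.src, q.ν⟩ : PBond P 0) ≠ b₀ := fun h => d24 (e2.trans h.symm)
      rw [if_neg e1, if_pos e2, if_neg e3, if_neg e4]; simp
    by_cases e3 : (⟨q.src.shift q.ν, q.μ⟩ : PBond P 0) = b₀
    · have e4 : (⟨q.src, q.ν⟩ : PBond P 0) ≠ b₀ := fun h => d34 (e3.trans h.symm)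
      rw [if_neg e1, if_neg e2, if_pos e3, if_neg e4]; simp [GaugeGroup.dist1_inv]
    by_cases e4 : (⟨q.src, q.ν⟩ : PBond P 0) = b₀
    · rw [if_neg e1, if_neg e2, if_neg e3, if_pos e4]; simp [GaugeGroup.dist1_inv]
    · rw [if_neg e1, if_neg e2, if_neg e3, if_neg e4]; simp [GaugeGroup.dist1_one, h0]

end OneBond

/-! ## §2  The corner obstruction with the sharp data room `t < δ₀` -/
section Corner

variable {F : T4Family} {N : ℕ} [NeZero N]

/-- **★ THE CORNER OBSTRUCTION, SHARP** (`N ≥ 2`): as part 1's `corner_forces`, with the data room `t < δ₀` (the one-bond datum's plaquettes are `≤ t`).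
[cite: Balaban1985Variational, Thm 1 (7)–(8) p.279; Balaban1988Convergent, (2.2) p.255, (2.10)–(2.12) p.256; Balaban1985RegularSpaces, (1.7) p.77 (bookkeeping)] -/
theorem corner_forces_sharp (hN : 2 ≤ N) (ν : Stage7Numerics) (K : ℕ) {δ : ℕ → ℝ} {t : ℝ} (ht0 : 0 ≤ t) (ht2 : t ≤ 2) (hδ0 : t < δ 0)
    (hδ1 : 0 < δ 1) (ε₀ B₃ : ℝ) :
    ∃ (s : SeqOfRecord F ν 1 (fun _ => (1 : ℝ)) K 1) (W : MSField (F.P K) (SU N)), Sect2.SeqSeparated ν.M₁ s ∧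
      (∀ n, n ≤ 1 → PlaqSmallOn (B8Eq17ClassAkV1.plaqsOf (genSet s.Ω 1 n)) (δ n) (W n)) ∧
      (((∃ U₀, IsMinimizer (avOfRecord F N K) {U | ∀ n, n ≤ 1 → PlaqSmallOn (omegaPlaqs s.Ω n) (ε₀ * (F.P K).eta n ^ 2) U} (genSet s.Ω 1) W U₀) ∧
        ∀ U₀, IsMinimizer (avOfRecord F N K) {U | ∀ n, n ≤ 1 → PlaqSmallOn (omegaPlaqs s.Ω n) (ε₀ * (F.P K).eta n ^ 2) U} (genSet s.Ω 1) W U₀ →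
          ∀ n, n ≤ 1 → PlaqSmallOn (omegaPlaqs s.Ω n) (B₃ * δ n * (F.P K).eta n ^ 2) U₀) →
        t < B₃ * δ 1 * (F.P K).eta 1 ^ 2) := by
  obtain ⟨s, hsΩ, hsep⟩ := exists_seq_singleCube F ν K
  obtain ⟨p, hpX, h1, h2, h3⟩ :=
    exists_corner_plaq (P := F.P K) (by rw [T4Family.P_d]; norm_num) F.hL.2.le (lt_sitesPerDir_zero F K)
  obtain ⟨D, hDle, hDge⟩ := exists_su_conj_norm_sub_one_ge (N := N) hN ht0 ht2
  have hDt : dist1 D = t := by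
    refine le_antisymm hDle ?_
    have h := hDge 1
    simp only [Units.val_one, inv_one, one_mul, mul_one] at h
    show t ≤ ‖(D : MatA N) - 1‖
    exact h
  obtain ⟨W0, hW0p, hW0q⟩ := exists_oneBond_cfg_sharp (one_lt_sitesPerDir_zero (F.P K)) D p
  let W : MSField (F.P K) (SU N) := fun j => match j with
    | 0 => W0
    | _ + 1 => fun _ => 1
  refine ⟨s, W, hsep, ?_, ?_⟩
  · intro n hn
    rcases Nat.le_one_iff_eq_zero_or_eq_one.mp hn with rfl | rfl
    · intro q _
      show dist1 (GaugeField.plaqHol W0 q) < δ 0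
      have := hW0q q
      rw [hDt] at this
      linarith
    · intro q _
      show dist1 (GaugeField.plaqHol (fun _ => (1 : SU N) : GaugeField (F.P K) 1 (SU N)) q) < δ 1
      simp only [GaugeField.plaqHol, inv_one, mul_one, GaugeGroup.dist1_one]
      exact hδ1
  · rintro ⟨⟨U₀, hU₀⟩, hall⟩
    have hp1 : p ∈ omegaPlaqs s.Ω 1 := by
      rw [omegaPlaqs_of_ne_zero s.Ω one_ne_zero, hsΩ]; exact hpX
    have hbound := hall U₀ hU₀ 1 le_rfl p hp1
    have hpin : GaugeField.plaqHol U₀ p = GaugeField.plaqHol (W 0) p :=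
      plaqHol_eq_of_agreeOn (avOfRecord F N K) one_pos hU₀.2.1 p (by rw [hsΩ]; exact h1) (by rw [hsΩ]; exact h2)
        (by rw [hsΩ]; exact h3)
    have hW0 : GaugeField.plaqHol (W 0) p = D := hW0p
    rw [hpin, hW0, hDt] at hbound
    exact hbound

end Corner

/-! ## §3  The sharp floors: `2L² ≤ B₃` under `…ScaledSep`, `L² ≤ B₃` under the uniform `…Class` -/
section Floors

variable {F : T4Family} {N : ℕ} [NeZero N]

/-- **★★ THE FAITHFUL FACT FORCES `B₃ ≥ 2L²`** (`N ≥ 2`, `0 < a₀`, `0 < a₁`; referee-H g5): thresholds `δ₁ := δ₀∕2` (comparability at equality), corner datum at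
`t := max(B₃,0)·δ₀∕(2L²) < δ₀` exactly when `B₃ < 2L²` — and then §2's `t < B₃·δ₁·η₁² = B₃·δ₀∕(2L²)` is absurd.
[cite: Balaban1985Variational, Thm 1 (7)–(8) p.279; Balaban1985RegularSpaces, (1.3)–(1.7) p.77; Balaban1988Convergent, (2.2) p.255, (2.12) p.256 (bookkeeping)] -/
theorem two_sq_L_le_of_variationalThm1ScaledSep (hN : 2 ≤ N) {B₃ a₀ a₁ : ℝ} (ha₀ : 0 < a₀) (ha₁ : 0 < a₁)
    (h : VariationalThm1ScaledSep F N B₃ a₀ a₁) : 2 * (F.L : ℝ) ^ 2 ≤ B₃ := by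
  by_contra hlt; rw [not_le] at hlt
  have hL1 : (1 : ℝ) ≤ F.L := by exact_mod_cast F.hL.2.le
  have hL0 : (F.L : ℝ) ≠ 0 := by positivity
  have hL2 : (0 : ℝ) < (F.L : ℝ) ^ 2 := by positivity
  set Bm : ℝ := max B₃ 1 with hBm
  have hBm1 : 1 ≤ Bm := le_max_right _ _
  have hBmpos : 0 < Bm := by linarith
  have hBle : B₃ ≤ Bm := le_max_left _ _
  set Bp : ℝ := max B₃ 0 with hBp
  have hBp0 : 0 ≤ Bp := le_max_right _ _
  have hBpL : Bp < 2 * (F.L : ℝ) ^ 2 := max_lt hlt (by positivity)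
  set δ₀ : ℝ := min (min a₁ 1) (a₀ / Bm) with hδ₀
  have hδ₀pos : 0 < δ₀ := lt_min (lt_min ha₁ one_pos) (div_pos ha₀ hBmpos)
  have hδ₀a₁ : δ₀ ≤ a₁ := (min_le_left _ _).trans (min_le_left _ _)
  have hδ₀one : δ₀ ≤ 1 := (min_le_left _ _).trans (min_le_right _ _)
  have hδ₀a₀ : Bm * δ₀ ≤ a₀ := (mul_le_mul_of_nonneg_left (min_le_right _ _) hBmpos.le).trans_eq (by field_simp)
  set δ₁ : ℝ := δ₀ / 2 with hδ₁
  have hδ₁pos : 0 < δ₁ := by positivity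
  have hδ₁le : δ₁ ≤ δ₀ := by rw [hδ₁]; linarith
  set t : ℝ := Bp * δ₀ / (2 * (F.L : ℝ) ^ 2) with ht
  have ht0 : 0 ≤ t := by positivity
  have htδ : t < δ₀ := by
    have h4 : t = (Bp / (2 * (F.L : ℝ) ^ 2)) * δ₀ := by rw [ht]; field_simp
    have hc : Bp / (2 * (F.L : ℝ) ^ 2) < 1 := by rw [div_lt_one (by positivity)]; linarith
    calc t = (Bp / (2 * (F.L : ℝ) ^ 2)) * δ₀ := h4
      _ < 1 * δ₀ := mul_lt_mul_of_pos_right hc hδ₀pos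
      _ = δ₀ := one_mul _
  have ht2 : t ≤ 2 := by linarith
  obtain ⟨s, W, hsep, hW, hforce⟩ := corner_forces_sharp (F := F) hN numerics7OfRecord₁₂ 1 (δ := fun n => if n = 0 then δ₀ else δ₁) (t := t)
    ht0 ht2 (by show t < δ₀; exact htδ) (by show 0 < δ₁; exact hδ₁pos) a₀ B₃
  have hδ : ∀ n, n ≤ 1 → 0 < (fun n => if n = 0 then δ₀ else δ₁) n ∧ (fun n => if n = 0 then δ₀ else δ₁) n ≤ a₁ ∧
      B₃ * (fun n => if n = 0 then δ₀ else δ₁) n ≤ a₀ := by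
    intro n hn
    rcases Nat.le_one_iff_eq_zero_or_eq_one.mp hn with rfl | rfl
    · show 0 < δ₀ ∧ δ₀ ≤ a₁ ∧ B₃ * δ₀ ≤ a₀
      exact ⟨hδ₀pos, hδ₀a₁, by nlinarith [mul_le_mul_of_nonneg_right hBle hδ₀pos.le]⟩
    · show 0 < δ₁ ∧ δ₁ ≤ a₁ ∧ B₃ * δ₁ ≤ a₀
      exact ⟨hδ₁pos, hδ₁le.trans hδ₀a₁,
        by nlinarith [mul_le_mul_of_nonneg_right hBle hδ₁pos.le, mul_le_mul_of_nonneg_left hδ₁le hBmpos.le]⟩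
  have hcomp : ∀ n, n < 1 → (fun n => if n = 0 then δ₀ else δ₁) n ≤ 2 * (fun n => if n = 0 then δ₀ else δ₁) (n + 1) := by
    intro n hn
    obtain rfl : n = 0 := by omega
    show δ₀ ≤ 2 * δ₁
    rw [hδ₁]; linarith
  have hlt' := hforce (h numerics7OfRecord₁₂ 1 (fun _ => (1 : ℝ)) 1 1 s hsep a₀ _ hδ hcomp le_rfl W hW)
  change t < B₃ * δ₁ * (F.P 1).eta 1 ^ 2 at hlt'
  rw [eta_one_sq (F := F) 1] at hlt'
  have hrhs : B₃ * δ₁ * ((F.L : ℝ) ^ 2)⁻¹ ≤ t := by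
    have hB : B₃ ≤ Bp := le_max_left _ _
    have h1 : B₃ * δ₁ ≤ Bp * δ₁ := mul_le_mul_of_nonneg_right hB hδ₁pos.le
    have h2 : B₃ * δ₁ * ((F.L : ℝ) ^ 2)⁻¹ ≤ Bp * δ₁ * ((F.L : ℝ) ^ 2)⁻¹ := mul_le_mul_of_nonneg_right h1 (by positivity)
    have h3 : Bp * δ₁ * ((F.L : ℝ) ^ 2)⁻¹ = t := by rw [ht, hδ₁]; field_simp
    linarith [h2, h3.le]
  exact absurd hlt' (not_lt.2 hrhs)

/-- `VariationalThm1ScaledSep` is false at every `B₃ < 2L²` (`N ≥ 2`, `0 < a₀`, `0 < a₁`). [cite: Balaban1985Variational, Thm 1 (8) p.279 (bookkeeping)] -/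
theorem not_variationalThm1ScaledSep_of_lt_two_sq (hN : 2 ≤ N) {B₃ a₀ a₁ : ℝ} (ha₀ : 0 < a₀) (ha₁ : 0 < a₁)
    (hB : B₃ < 2 * (F.L : ℝ) ^ 2) : ¬ VariationalThm1ScaledSep F N B₃ a₀ a₁ :=
  fun h => absurd (two_sq_L_le_of_variationalThm1ScaledSep hN ha₀ ha₁ h) (not_le.2 hB)

/-- **★ THE PRINTED UNIFORM FACT FORCES `B₃ ≥ L²`** (`N ≥ 2`, `0 < a₀`, `0 < a₁`): with ONE threshold `ε₁` at both scales the corner datum at `t := max(B₃,0)·ε₁∕L² < ε₁`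
(exactly when `B₃ < L²`) makes §2's `t < B₃·ε₁·η₁²` absurd.  (Print: the corner plaquette is pinned at tolerance `ε₁` by (7) on `Γ₀` and demanded `< B₃ε₁L⁻²` by
(8) at `j = 1`, so [15] Thm 1's own `B₃(d, L)` is `≥ L²` in this convention.) [cite: Balaban1985Variational, Thm 1 (7)–(8) p.279; Balaban1985RegularSpaces, (1.7) p.77 (bookkeeping)] -/
theorem sq_L_le_of_variationalThm1Class (hN : 2 ≤ N) {B₃ a₀ a₁ : ℝ} (ha₀ : 0 < a₀) (ha₁ : 0 < a₁)
    (h : VariationalThm1Class F N B₃ a₀ a₁) : (F.L : ℝ) ^ 2 ≤ B₃ := by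
  by_contra hlt; rw [not_le] at hlt
  have hL1 : (1 : ℝ) ≤ F.L := by exact_mod_cast F.hL.2.le
  have hL0 : (F.L : ℝ) ≠ 0 := by positivity
  have hL2 : (0 : ℝ) < (F.L : ℝ) ^ 2 := by positivity
  set Bm : ℝ := max B₃ 1 with hBm
  have hBm1 : 1 ≤ Bm := le_max_right _ _
  have hBmpos : 0 < Bm := by linarith
  have hBle : B₃ ≤ Bm := le_max_left _ _
  set Bp : ℝ := max B₃ 0 with hBp
  have hBp0 : 0 ≤ Bp := le_max_right _ _
  have hBpL : Bp < (F.L : ℝ) ^ 2 := max_lt hlt hL2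
  set ε₁ : ℝ := min (min a₁ 1) (a₀ / Bm) with hε₁
  have hε₁pos : 0 < ε₁ := lt_min (lt_min ha₁ one_pos) (div_pos ha₀ hBmpos)
  have hε₁a₁ : ε₁ ≤ a₁ := (min_le_left _ _).trans (min_le_left _ _)
  have hε₁one : ε₁ ≤ 1 := (min_le_left _ _).trans (min_le_right _ _)
  have hε₁a₀ : Bm * ε₁ ≤ a₀ := (mul_le_mul_of_nonneg_left (min_le_right _ _) hBmpos.le).trans_eq (by field_simp)
  set t : ℝ := Bp * ε₁ / (F.L : ℝ) ^ 2 with ht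
  have ht0 : 0 ≤ t := by positivity
  have htδ : t < ε₁ := by
    have h4 : t = (Bp / (F.L : ℝ) ^ 2) * ε₁ := by rw [ht]; field_simp
    have hc : Bp / (F.L : ℝ) ^ 2 < 1 := by rw [div_lt_one hL2]; exact hBpL
    calc t = (Bp / (F.L : ℝ) ^ 2) * ε₁ := h4
      _ < 1 * ε₁ := mul_lt_mul_of_pos_right hc hε₁pos
      _ = ε₁ := one_mul _
  have ht2 : t ≤ 2 := by linarith
  obtain ⟨s, W, -, hW, hforce⟩ := corner_forces_sharp (F := F) hN numerics7OfRecord₁₂ 1 (δ := fun _ => ε₁) (t := t)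
    ht0 ht2 htδ hε₁pos a₀ B₃
  have hlt' := hforce (h numerics7OfRecord₁₂ 1 (fun _ => (1 : ℝ)) 1 1 s a₀ ε₁ hε₁pos hε₁a₁
    (by nlinarith [mul_le_mul_of_nonneg_right hBle hε₁pos.le]) le_rfl W hW)
  rw [eta_one_sq (F := F) 1] at hlt'
  have hrhs : B₃ * ε₁ * ((F.L : ℝ) ^ 2)⁻¹ ≤ t := by
    have hB : B₃ ≤ Bp := le_max_left _ _
    have h1 : B₃ * ε₁ ≤ Bp * ε₁ := mul_le_mul_of_nonneg_right hB hε₁pos.le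
    have h2 : B₃ * ε₁ * ((F.L : ℝ) ^ 2)⁻¹ ≤ Bp * ε₁ * ((F.L : ℝ) ^ 2)⁻¹ := mul_le_mul_of_nonneg_right h1 (by positivity)
    have h3 : Bp * ε₁ * ((F.L : ℝ) ^ 2)⁻¹ = t := by rw [ht]; field_simp
    linarith [h2, h3.le]
  exact absurd hlt' (not_lt.2 hrhs)

/-- `VariationalThm1Class` is false at every `B₃ < L²` (`N ≥ 2`, `0 < a₀`, `0 < a₁`). [cite: Balaban1985Variational, Thm 1 (8) p.279 (bookkeeping)] -/
theorem not_variationalThm1Class_of_lt_sq (hN : 2 ≤ N) {B₃ a₀ a₁ : ℝ} (ha₀ : 0 < a₀) (ha₁ : 0 < a₁) (hB : B₃ < (F.L : ℝ) ^ 2) :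
    ¬ VariationalThm1Class F N B₃ a₀ a₁ :=
  fun h => absurd (sq_L_le_of_variationalThm1Class hN ha₀ ha₁ h) (not_le.2 hB)

end Floors

end Summit.QuantumFields.YangMills.Theorems.K0VariationalThm1ScaledCorner

end
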